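import Summits.ResolutionOfSingularities.ResolutionOfSingularities.Theorems.HilbertSamuelEliminationSigmaMaxModificationsCorridor3HypersurfaceHilbertFunction
import Literature.RingTheory.HilbertSamuel.TangentConeInitialForms
import Literature.RingTheory.MvPolynomial.DirectrixLinForm
import Summits.ResolutionOfSingularities.ResolutionOfSingularities.Theorems.HilbertSamuelEliminationSigmaMaxModificationsCorridor3HypersurfaceValues
import Literature.RingTheory.HilbertSamuel.ProjDirectrixLine
import Literature.RingTheory.HilbertSamuel.TangentConeBaseChange
import Literature.RingTheory.HilbertSamuel.FlatBaseChange
import Literature.RingTheory.HilbertSamuel.RegularCriterion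
import Literature.RingTheory.HilbertSamuel.Quotient
import HarnessLib

/-!
# [OURS · L1 W4.2] The `e = 1` door through the arc, step 2b/3 — **transport lemmas for hypersurface presentations
# `σ : R ↠ 𝒪`, `ker σ = (h)`**: the tangent cone of `𝒪` in the pushed generators is `(in h)` up to the residue-field
# isomorphism; the embedding dimension of `𝒪`; and **LEMMA O**: at the ORIGIN of the `t`-chart, `ℙ(Dir)` forces the directrix hyperplane
# to be `⊕_{k ≠ j₀} κ C_k` (crux `SigmaMaxModifications` stmt-ResolutionOfSingularities-18506 / conjunct stmt-…-19249, line `w_ladder`,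
# row `stub_Wlow3M_two` (β); `--supports 19249`, helper)

Stub worker res-L1-w42-stub-3 (gen 5). Sorry-free PROOF file, no definition, no named fact. OURS bookkeeping for the W4.2 crux chain
(cell res-hironaka); NOT a statement of [Hironaka2017] nor of [CossartJannsenSaito2020]. AI-written; AI review is weaker than expert review.

* `E1Free.span_range_comp_eq_maximalIdeal` — generators of `𝔪_R` pushed along a surjection `σ : R ↠ A` generate `𝔪_A`.
* `E1Free.exists_tangentConeIdeal_eq_map_span_singleton` — **LEMMA T**: for `σ : R ↠ A`, `ker σ = (h)`, `R` regular local with regular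
  parameters `y`, `h ∈ 𝔪^m ∖ 𝔪^{m+1}` with initial form `F`: `J_A(σ ∘ y) = (F) · κ(A)[X]` along a BIJECTIVE `κ : κ(R) → κ(A)`
  (`tangentConeIdeal_quotient_eq_map_initialIdeal` + `Helpers.initialIdeal_span_singleton` + `tangentConeIdeal_eq_map` along `R/(h) ≅ A`).
* `E1Free.spanFinrank_maximalIdeal_eq_of_presentation` — `emb.dim A = emb.dim R` when `m ≥ 2` (`H^{(0)}(A)(1) = hypersurfaceHFe d m 1 = d`).
* `E1Free.coeff_eq_zero_of_projDirLiftsInto_origin` — **LEMMA O**: `φ : A → B`, generators `x` of `𝔪_A` with `φ(x_k) ∈ (φ t)·𝔪_B`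
  (`k ≠ j₀`, `t = x_{j₀}`: the point is the ORIGIN of the `t`-chart) and `φ t` a non-zero-divisor; if `φ` satisfies `ProjDirLiftsInto`
  («the point lies on `ℙ(Dir(A))`») then every directrix linear form has `X_{j₀}`-coefficient `0`: `𝒯(A) ≤ ⊕_{k ≠ j₀} κ X_k`
  (`le_span_X_of_forall_coeff_eq_zero`).

[OURS · L1 W4.2; AI-written] [cite: CossartJannsenSaito2020, §2.2 (p. 24), Lemma 2.7, Def. 2.18, Lemma 2.27 (1), Def. 6.34 (i)]
-/

set_option linter.dupNamespace false

noncomputable section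

open IsLocalRing MvPolynomial Module
open Literature.RingTheory.MvPolynomial Literature.RingTheory.HilbertSamuel Literature.AlgebraicGeometry.Resolution
open Summit.ResolutionOfSingularities.ResolutionOfSingularities.Theorems.SigmaMaxModificationsCorridor3.Helpers

namespace Summit.ResolutionOfSingularities.ResolutionOfSingularities.Theorems.SigmaMaxModificationsCorridor3.E1Free

universe u

/-! ## Pushed generators -/

/-- Generators of `𝔪_R` pushed along a surjection of local rings generate `𝔪_A`. [folklore] -/
theorem span_range_comp_eq_maximalIdeal {R A : Type u} [CommRing R] [IsLocalRing R] [CommRing A] [IsLocalRing A]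
    {d : ℕ} {c : Fin d → R} (hc : Ideal.span (Set.range c) = maximalIdeal R) (σ : R →+* A)
    (hσ : Function.Surjective σ) : Ideal.span (Set.range (σ ∘ c)) = maximalIdeal A := by
  rw [Set.range_comp, ← Ideal.map_span, hc]
  exact IsLocalRing.map_maximalIdeal_of_surjective σ hσ

/-- `tangentConeIdeal` only depends on the family of generators (bookkeeping for propositionally equal families). [folklore] -/
theorem tangentConeIdeal_congr {A : Type u} [CommRing A] [IsLocalRing A] {e : ℕ} {x x' : Fin e → A} (h : x = x')
    (hx : Ideal.span (Set.range x) = maximalIdeal A) (hx' : Ideal.span (Set.range x') = maximalIdeal A) :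
    tangentConeIdeal x hx = tangentConeIdeal x' hx' := by
  subst h; rfl

/-! ## LEMMA T: the tangent cone of a hypersurface presentation -/

section Presentation

variable {R A : Type u} [CommRing R] [IsRegularLocalRing R] [CommRing A] [IsLocalRing A] [IsNoetherianRing A]
  {d : ℕ} (hd : (maximalIdeal R).spanFinrank = d) (y : Fin d → R) (hy : Ideal.span (Set.range y) = maximalIdeal R)
  (σ : R →+* A) (hσ : Function.Surjective σ) {h : R} (hker : RingHom.ker σ = Ideal.span {h})

include hσ hker in
omit [IsRegularLocalRing R] [IsNoetherianRing A] hd hy in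
/-- `R ⧸ (h)` is nontrivial (it is `≅ A`, a local ring). [folklore] -/
theorem nontrivial_quotient_of_presentation [IsLocalRing R] : Nontrivial (R ⧸ Ideal.span {h}) := by
  rw [← hker]
  exact (RingHom.quotientKerEquivOfSurjective hσ).toEquiv.nontrivial

include hσ hker in
omit [IsRegularLocalRing R] [IsLocalRing A] [IsNoetherianRing A] hd hy in
/-- The presentation isomorphism `R ⧸ (h) ≃ A` over `σ`. [folklore] -/
theorem exists_ringEquiv_quotient_of_presentation [IsLocalRing R] :
    ∃ e : R ⧸ Ideal.span {h} ≃+* A, ∀ r, e (Ideal.Quotient.mk _ r) = σ r := by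
  refine ⟨(Ideal.quotEquivOfEq hker.symm).trans (RingHom.quotientKerEquivOfSurjective hσ), fun r => ?_⟩
  rw [RingEquiv.trans_apply, Ideal.quotEquivOfEq_mk]
  rfl

include hd hy hσ hker in
/-- **LEMMA T — the tangent cone of a hypersurface presentation.** `σ : R ↠ A`, `ker σ = (h)`, `R` regular local with regular parameters `y`,
`h ∈ 𝔪^m ∖ 𝔪^{m+1}` with an initial form `F` of degree `m`: the tangent cone ideal of `A` in the pushed generators `σ ∘ y` is the extension
of `(F)` along a BIJECTIVE homomorphism `κ : κ(R) → κ(A)` of residue fields. [OURS · L1 W4.2; AI-written]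
[cite: CossartJannsenSaito2020, §2.2 (p. 24), Lemma 2.27 (1)] -/
theorem exists_tangentConeIdeal_eq_map_span_singleton {m : ℕ} (hm : h ∈ maximalIdeal R ^ m)
    (hm' : h ∉ maximalIdeal R ^ (m + 1)) {F : MvPolynomial (Fin d) (ResidueField R)} (hF : F ∈ initialFormsOf y h m)
    (hσy : Ideal.span (Set.range (σ ∘ y)) = maximalIdeal A) :
    ∃ κ : ResidueField R →+* ResidueField A, Function.Bijective κ ∧
      tangentConeIdeal (σ ∘ y) hσy = (Ideal.span {F}).map (MvPolynomial.map κ) := by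
  set J : Ideal R := Ideal.span {h} with hJ
  haveI : Nontrivial (R ⧸ J) := nontrivial_quotient_of_presentation σ hσ hker
  obtain ⟨e, he⟩ := exists_ringEquiv_quotient_of_presentation σ hσ hker
  -- `J_{R/J}(ȳ) = (F) · κ(R/J)[X]`
  have h1 : tangentConeIdeal (fun i => Ideal.Quotient.mk J (y i)) (span_range_mk_comp_eq y hy J) =
      (Ideal.span {F}).map (MvPolynomial.map (ResidueField.map (Ideal.Quotient.mk J))) := by
    rw [tangentConeIdeal_quotient_eq_map_initialIdeal y hy J, initialIdeal_span_singleton hd y hy hm hm' hF]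
  -- transport along `e : R/J ≃ A` (flat, `𝔪 ↦ 𝔪`)
  letI : Algebra (R ⧸ J) A := (e : R ⧸ J →+* A).toAlgebra
  haveI : Module.Flat (R ⧸ J) A :=
    RingHom.flat_algebraMap_iff.mp (RingHom.Flat.of_bijective (f := (e : R ⧸ J →+* A)) e.bijective)
  have hmJ : (maximalIdeal (R ⧸ J)).map (algebraMap (R ⧸ J) A) = maximalIdeal A :=
    IsLocalRing.map_maximalIdeal_of_surjective _ e.surjective
  haveI : IsLocalHom (algebraMap (R ⧸ J) A) := isLocalHom_of_map_maximalIdeal_eq hmJ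
  have h2 := tangentConeIdeal_eq_map hmJ (fun i => Ideal.Quotient.mk J (y i)) (span_range_mk_comp_eq y hy J)
  have hfun : (fun i => algebraMap (R ⧸ J) A (Ideal.Quotient.mk J (y i))) = σ ∘ y := funext fun i => he (y i)
  refine ⟨(ResidueField.map (algebraMap (R ⧸ J) A)).comp (ResidueField.map (Ideal.Quotient.mk J)),
    (ResidueField.mapEquiv e).bijective.comp (residueField_map_mk_bijective J), ?_⟩
  rw [← tangentConeIdeal_congr hfun (span_range_algebraMap_eq hmJ _ (span_range_mk_comp_eq y hy J)) hσy, h2, h1,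
    Ideal.map_map]
  congr 1
  exact RingHom.ext fun p => (MvPolynomial.map_map _ _ p)

include hd hσ hker in
omit hy in
/-- **The embedding dimension of a hypersurface singularity of multiplicity `m ≥ 2`: `emb.dim A = emb.dim R`** (`H^{(0)}(A)(1) =
hypersurfaceHFe d m (1) = d`). [OURS · L1 W4.2; AI-written] [cite: CossartJannsenSaito2020, Thm. 2.3] -/
theorem spanFinrank_maximalIdeal_eq_of_presentation {m : ℕ} (hm2 : 2 ≤ m) (hm : h ∈ maximalIdeal R ^ m)
    (hm' : h ∉ maximalIdeal R ^ (m + 1)) (hd1 : 1 ≤ d) : (maximalIdeal A).spanFinrank = d := by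
  haveI : Nontrivial (R ⧸ Ideal.span {h}) := nontrivial_quotient_of_presentation σ hσ hker
  obtain ⟨e, -⟩ := exists_ringEquiv_quotient_of_presentation σ hσ hker
  rw [← hilbertFun_one_eq_spanFinrank, ← hilbertFun_eq_of_ringEquiv e, hilbertFun_quotient_span_singleton hd hm hm']
  obtain ⟨t, rfl⟩ : ∃ t, d = t + 1 := ⟨d - 1, by omega⟩
  exact hypersurfaceHFe_succ_apply_one hm2

end Presentation

/-! ## LEMMA O: at the ORIGIN of the `t`-chart, `ℙ(Dir)` forces `𝒯 ≤ ⊕_{k ≠ j₀} κ X_k` -/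

/-- A subspace of linear forms all of whose members have vanishing `X_{j₀}`-coefficient lies in `⊕_{i ≠ j₀} k X_i`. [folklore] -/
theorem le_span_X_of_forall_coeff_eq_zero {K : Type u} [Field K] {n : ℕ} {W : Submodule K (MvPolynomial (Fin n) K)}
    (hW1 : W ≤ homogeneousSubmodule (Fin n) K 1) (j₀ : Fin n)
    (h : ∀ L ∈ W, MvPolynomial.coeff (Finsupp.single j₀ 1) L = 0) :
    W ≤ Submodule.span K (X '' {i | i ≠ j₀}) := by
  intro L hL
  obtain ⟨v, rfl⟩ := exists_eq_linForm_of_mem (hW1 hL)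
  have hv : v j₀ = 0 := by rw [← coeff_single_one_linForm v j₀]; exact h _ hL
  rw [linForm_apply]
  refine Submodule.sum_mem _ fun i _ => ?_
  by_cases hi : i = j₀
  · subst hi; rw [hv, zero_smul]; exact zero_mem _
  · exact Submodule.smul_mem _ _ (Submodule.subset_span ⟨i, hi, rfl⟩)

/-- **LEMMA O.** `φ : A → B` a homomorphism of local rings, `x` generators of `𝔪_A`, `t = x_{j₀}` with `φ t` a non-zero-divisor and
`φ(x_k) ∈ (φ t)·𝔪_B` for `k ≠ j₀` (the point `B` is the ORIGIN of the `t`-chart of the blow-up of `𝔪_A`). If the point lies on `ℙ(Dir(A))`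
(`ProjDirLiftsInto φ x`), then every linear form of the directrix space `𝒯(J_A(x))` has `X_{j₀}`-coefficient `0`.
Proof: lift `L ∈ 𝒯` to `l = Σ c_i x_i`; `φ l ∈ (𝔪_A B)·𝔪_B ⊆ (φ t)·𝔪_B` and `Σ_{i ≠ j₀} φ(c_i x_i) ∈ (φ t)·𝔪_B`, so
`φ(c_{j₀})·φ t ∈ (φ t)·𝔪_B`, whence `φ(c_{j₀}) ∈ 𝔪_B` and `c_{j₀} ∈ 𝔪_A`. [OURS · L1 W4.2; AI-written]
[cite: CossartJannsenSaito2020, Def. 6.34 (i), Def. 2.18] -/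
theorem coeff_eq_zero_of_projDirLiftsInto_origin {A B : Type u} [CommRing A] [IsLocalRing A] [CommRing B] [IsLocalRing B]
    (φ : A →+* B) {e : ℕ} {x : Fin e → A} (hx : Ideal.span (Set.range x) = maximalIdeal A) (j₀ : Fin e)
    (horig : ∀ k, k ≠ j₀ → φ (x k) ∈ Ideal.span {φ (x j₀)} * maximalIdeal B)
    (hnzd : φ (x j₀) ∈ nonZeroDivisors B) (hP : ProjDirLiftsInto φ x hx)
    {L : MvPolynomial (Fin e) (ResidueField A)} (hL : L ∈ directrixSpace (tangentConeIdeal x hx)) :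
    MvPolynomial.coeff (Finsupp.single j₀ 1) L = 0 := by
  classical
  obtain ⟨s, hs⟩ : ∃ s : ResidueField A → A, ∀ a, residue A (s a) = a :=
    ⟨Function.surjInv Ideal.Quotient.mk_surjective, Function.surjInv_eq Ideal.Quotient.mk_surjective⟩
  set c : Fin e → A := fun i => s (MvPolynomial.coeff (Finsupp.single i 1) L) with hcdef
  have hc : ∀ i, residue A (c i) = MvPolynomial.coeff (Finsupp.single i 1) L := fun i => hs _
  have hmem := hP L hL c hc
  -- `(𝔪_A B)·𝔪_B ⊆ (φ t)·𝔪_B`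
  set P : Ideal B := Ideal.span {φ (x j₀)} * maximalIdeal B with hPdef
  have hmaple : (maximalIdeal A).map φ ≤ Ideal.span {φ (x j₀)} := by
    rw [← hx, Ideal.map_span, Ideal.span_le]
    rintro _ ⟨_, ⟨k, rfl⟩, rfl⟩
    by_cases hk : k = j₀
    · subst hk; exact Ideal.mem_span_singleton_self _
    · exact Ideal.mul_le_right (horig k hk)
  have hmem' : φ (∑ i, c i * x i) ∈ P := Ideal.mul_mono_left hmaple hmem
  -- isolate the `j₀`-term
  have hsplit : φ (∑ i, c i * x i) = φ (c j₀) * φ (x j₀) + ∑ i ∈ Finset.univ.erase j₀, φ (c i) * φ (x i) := by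
    rw [map_sum, ← Finset.add_sum_erase _ _ (Finset.mem_univ j₀)]
    simp only [map_mul]
  have hrest : ∑ i ∈ Finset.univ.erase j₀, φ (c i) * φ (x i) ∈ P :=
    Ideal.sum_mem _ fun i hi => Ideal.mul_mem_left _ _ (horig i (Finset.ne_of_mem_erase hi))
  have hj : φ (c j₀) * φ (x j₀) ∈ P := by
    have := P.sub_mem hmem' hrest
    rwa [hsplit, add_sub_cancel_right] at this
  -- cancel the non-zero-divisor `φ t`
  obtain ⟨b, hb, hbeq⟩ := Ideal.mem_span_singleton_mul.mp hj
  have hcj : φ (c j₀) = b := by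
    have h0 : (φ (c j₀) - b) * φ (x j₀) = 0 := by rw [sub_mul, ← hbeq]; ring
    exact sub_eq_zero.mp ((mem_nonZeroDivisors_iff_right.mp hnzd) _ h0)
  have hcjm : c j₀ ∈ maximalIdeal A := by
    by_contra hu
    have hunit : IsUnit (φ (c j₀)) := (IsLocalRing.notMem_maximalIdeal.mp hu).map φ
    exact (IsLocalRing.notMem_maximalIdeal.mpr hunit) (hcj ▸ hb)
  rw [← hc j₀]
  exact (residue_eq_zero_iff _).mpr hcjm

end Summit.ResolutionOfSingularities.ResolutionOfSingularities.Theorems.SigmaMaxModificationsCorridor3.E1Free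

end
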